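import Mathlib
import HarnessLib

/-!
# STAGED door S15 `LocalIrrotationalScarDoor` (nsreg-p1 ROUND-14), zoom crux `K1Rep` (`LocalPointZoomScarCurlRep`) —
# support tools, part 1: derivatives of a pointwise limit with a `C¹` trace, and the linear rate from a bounded time
# derivative

Two elementary calculus lemmas used in step (iii) of the `K1Rep` plan (ROUND-14 §4 Day 2: the top-curl fading of the
zoom limit on the side `S`):

* `tendsto_fderiv_apply_of_tendsto_of_taylor` / `tendsto_fderiv_of_tendsto_of_taylor` — **derivatives of a pointwise
  limit**: if `f i → g` pointwise on a ball around `x`, the `f i` satisfy a UNIFORM first-order Taylor bound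
  `‖f i (x + h) − f i x − D(f i)(x) h‖ ≤ K ‖h‖²` (`‖h‖ < r`), and the limit `g` is differentiable at `x`, then
  `D(f i)(x) → Dg(x)` (on vectors, and in operator norm when the source is finite-dimensional).  This is how the
  pointwise velocity trace `u(t,·) → u(T,·)` on the side together with `u(T,·) ∈ C¹` and uniform `C²` bounds
  identifies `lim_{t↑T} curl u(t,x)` with `curl u(T,x)`;
* `norm_le_mul_of_deriv_bound_of_tendsto_zero` — **linear rate from a bounded derivative and a vanishing trace**:
  `‖φ′‖ ≤ K` on `]s₀, 0[` and `φ(s) → 0` as `s ↑ 0` give `‖φ(s)‖ ≤ K·(−s)`.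

Seat nsreg-p6 g7; helper toward the S15 zoom crux (anchor `--supports stmt-NavierStokesRegularity-11719`, the
RellichScar apex-localisation crux the door's kit serves).  WHAT THIS IS NOT: not NS-specific; not `K1Rep`.
-/

noncomputable section

open Set Function Filter Topology Metric

-- the summit and its single sub-problem share the name (CONVENTIONS §1), as in every Theorems file
set_option linter.dupNamespace false

namespace Summit.NavierStokesRegularity.NavierStokesRegularity.Theorems.LocalIrrotationalScarDoorZoomTraceTools

variable {ι : Type*} {l : Filter ι} {E F : Type*} [NormedAddCommGroup E] [NormedSpace ℝ E]
  [NormedAddCommGroup F] [NormedSpace ℝ F]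

/-- **Derivatives of a pointwise limit, applied to a vector.**  `f i → g` pointwise on `ball x r`, a uniform
first-order Taylor bound for the `f i` at `x`, and differentiability of `g` at `x` give
`D(f i)(x) h → Dg(x) h` for every `h`. [folklore] -/
theorem tendsto_fderiv_apply_of_tendsto_of_taylor {f : ι → E → F} {g : E → F} {x : E} {r K : ℝ} (hr : 0 < r)
    (hlim : ∀ y ∈ ball x r, Tendsto (fun i => f i y) l (𝓝 (g y)))
    (htaylor : ∀ᶠ i in l, ∀ h : E, ‖h‖ < r → ‖f i (x + h) - f i x - fderiv ℝ (f i) x h‖ ≤ K * ‖h‖ ^ 2)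
    (hg : DifferentiableAt ℝ g x) (h : E) :
    Tendsto (fun i => fderiv ℝ (f i) x h) l (𝓝 (fderiv ℝ g x h)) := by
  rcases eq_or_ne h 0 with rfl | hh
  · simpa using tendsto_const_nhds
  have hK : ∀ᶠ i in l, 0 ≤ K := by
    filter_upwards [htaylor] with i hi
    have h0 := hi 0 (by simpa using hr)
    simp only [add_zero, sub_self, map_zero, norm_zero, zero_pow two_ne_zero, mul_zero, le_refl] at h0
    -- use a small nonzero vector to read off `0 ≤ K`
    obtain ⟨τ, hτ, hτr⟩ : ∃ τ : ℝ, 0 < τ ∧ τ * ‖h‖ < r :=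
      ⟨r / (2 * ‖h‖), by positivity, by rw [div_mul_eq_mul_div, div_lt_iff₀ (by positivity)]; nlinarith [norm_pos_iff.2 hh]⟩
    have h1 := hi (τ • h) (by rwa [norm_smul, Real.norm_of_nonneg hτ.le])
    have h2 : 0 < ‖τ • h‖ ^ 2 := by
      rw [norm_smul, Real.norm_of_nonneg hτ.le]; exact pow_pos (mul_pos hτ (norm_pos_iff.2 hh)) 2
    exact nonneg_of_mul_nonneg_left ((norm_nonneg _).trans h1) h2
  rw [Metric.tendsto_nhds]
  intro ε hε
  have hhn : 0 < ‖h‖ := norm_pos_iff.2 hh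
  -- the little-o bound for `g` at `x`
  have hgo := hg.hasFDerivAt.isLittleO
  rw [Asymptotics.isLittleO_iff] at hgo
  have hc : (0 : ℝ) < ε / (4 * ‖h‖) := by positivity
  have hgδ := hgo hc
  rw [Filter.eventually_iff_exists_mem] at hgδ
  obtain ⟨V, hV, hVg⟩ := hgδ
  obtain ⟨δ, hδ, hδV⟩ := Metric.mem_nhds_iff.1 hV
  -- choose the step `τ`: `τ‖h‖ < min r δ` and `K τ ‖h‖ ≤ ε/4` (when `K > 0`)
  obtain ⟨τ, hτ, hτr, hτδ, hτK⟩ : ∃ τ : ℝ, 0 < τ ∧ τ * ‖h‖ < r ∧ τ * ‖h‖ < δ ∧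
      ∀ K' : ℝ, 0 ≤ K' → K' ≤ K → K' * τ * ‖h‖ ^ 2 ≤ ε / 4 := by
    refine ⟨min (min (r / (2 * ‖h‖)) (δ / (2 * ‖h‖))) (ε / (4 * (|K| + 1) * ‖h‖ ^ 2)), by positivity,
      ?_, ?_, ?_⟩
    · calc min (min (r / (2 * ‖h‖)) (δ / (2 * ‖h‖))) (ε / (4 * (|K| + 1) * ‖h‖ ^ 2)) * ‖h‖
          ≤ r / (2 * ‖h‖) * ‖h‖ := by gcongr; exact (min_le_left _ _).trans (min_le_left _ _)
        _ = r / 2 := by field_simp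
        _ < r := by linarith
    · calc min (min (r / (2 * ‖h‖)) (δ / (2 * ‖h‖))) (ε / (4 * (|K| + 1) * ‖h‖ ^ 2)) * ‖h‖
          ≤ δ / (2 * ‖h‖) * ‖h‖ := by gcongr; exact (min_le_left _ _).trans (min_le_right _ _)
        _ = δ / 2 := by field_simp
        _ < δ := by linarith
    · intro K' hK'0 hK'K
      have hK'abs : K' ≤ |K| + 1 := hK'K.trans ((le_abs_self K).trans (by linarith))
      calc K' * min (min (r / (2 * ‖h‖)) (δ / (2 * ‖h‖))) (ε / (4 * (|K| + 1) * ‖h‖ ^ 2)) * ‖h‖ ^ 2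
          ≤ K' * (ε / (4 * (|K| + 1) * ‖h‖ ^ 2)) * ‖h‖ ^ 2 := by gcongr; exact min_le_right _ _
        _ = K' / (|K| + 1) * (ε / 4) := by field_simp
        _ ≤ 1 * (ε / 4) := by
            gcongr
            rw [div_le_one (by positivity)]
            exact hK'abs
        _ = ε / 4 := one_mul _
  set k : E := τ • h with hk
  have hknorm : ‖k‖ = τ * ‖h‖ := by rw [hk, norm_smul, Real.norm_of_nonneg hτ.le]
  have hkr : ‖k‖ < r := by rwa [hknorm]
  have hkV : x + k ∈ V := hδV (by rw [mem_ball, dist_eq_norm, add_sub_cancel_left, hknorm]; exact hτδ)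
  -- the two pointwise convergences, at `x` and at `x + k`
  have hx : Tendsto (fun i => f i x) l (𝓝 (g x)) := hlim x (mem_ball_self hr)
  have hxk : Tendsto (fun i => f i (x + k)) l (𝓝 (g (x + k))) :=
    hlim (x + k) (by rw [mem_ball, dist_eq_norm, add_sub_cancel_left]; exact hkr)
  have hsmall : 0 < ε * τ / 8 := by positivity
  have hx' := (Metric.tendsto_nhds.1 hx) (ε * τ / 8) hsmall
  have hxk' := (Metric.tendsto_nhds.1 hxk) (ε * τ / 8) hsmall
  filter_upwards [htaylor, hK, hx', hxk'] with i hi hKi hxi hxki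
  have h1 := hi k hkr
  have h2 : ‖g (x + k) - g x - fderiv ℝ g x k‖ ≤ ε / (4 * ‖h‖) * ‖k‖ := by
    have := hVg (x + k) hkV
    simpa [add_sub_cancel_left] using this
  rw [dist_eq_norm] at hxi hxki ⊢
  -- `τ (A_i h - A h) = (f_i(x+k) - f_i x - A_i k) ... ` rearranged
  have hcombo : (g (x + k) - g x - fderiv ℝ g x k) - (f i (x + k) - f i x - fderiv ℝ (f i) x k) +
        (f i (x + k) - g (x + k)) - (f i x - g x) = τ • (fderiv ℝ (f i) x h - fderiv ℝ g x h) := by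
    rw [hk, map_smul, map_smul, smul_sub]
    abel
  have hident : fderiv ℝ (f i) x h - fderiv ℝ g x h =
      τ⁻¹ • ((g (x + k) - g x - fderiv ℝ g x k) - (f i (x + k) - f i x - fderiv ℝ (f i) x k) +
        (f i (x + k) - g (x + k)) - (f i x - g x)) := by
    rw [hcombo, smul_smul, inv_mul_cancel₀ hτ.ne', one_smul]
  rw [hident, norm_smul, norm_inv, Real.norm_of_nonneg hτ.le]
  have hbound : ‖(g (x + k) - g x - fderiv ℝ g x k) - (f i (x + k) - f i x - fderiv ℝ (f i) x k) +
        (f i (x + k) - g (x + k)) - (f i x - g x)‖ < ε * τ := by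
    have hK1 : K * ‖k‖ ^ 2 ≤ ε / 4 * τ := by
      rw [hknorm]
      have := hτK K hKi le_rfl
      have e : K * (τ * ‖h‖) ^ 2 = τ * (K * τ * ‖h‖ ^ 2) := by ring
      rw [e]
      nlinarith [hτ]
    have hg1 : ε / (4 * ‖h‖) * ‖k‖ = ε / 4 * τ := by rw [hknorm]; field_simp
    calc ‖(g (x + k) - g x - fderiv ℝ g x k) - (f i (x + k) - f i x - fderiv ℝ (f i) x k) +
          (f i (x + k) - g (x + k)) - (f i x - g x)‖
        ≤ ‖g (x + k) - g x - fderiv ℝ g x k‖ + ‖f i (x + k) - f i x - fderiv ℝ (f i) x k‖ +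
            ‖f i (x + k) - g (x + k)‖ + ‖f i x - g x‖ := by
          refine (norm_sub_le _ _).trans ?_
          refine add_le_add ((norm_add_le _ _).trans (add_le_add (norm_sub_le _ _) le_rfl)) le_rfl
      _ < ε / 4 * τ + ε / 4 * τ + ε * τ / 8 + ε * τ / 8 := by
          have := add_lt_add_of_le_of_lt (add_le_add (h2.trans_eq hg1) (h1.trans hK1)) hxki
          linarith
      _ ≤ ε * τ := by nlinarith
  calc τ⁻¹ * ‖(g (x + k) - g x - fderiv ℝ g x k) - (f i (x + k) - f i x - fderiv ℝ (f i) x k) +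
        (f i (x + k) - g (x + k)) - (f i x - g x)‖
      < τ⁻¹ * (ε * τ) := mul_lt_mul_of_pos_left hbound (inv_pos.2 hτ)
    _ = ε := by field_simp

/-- **Derivatives of a pointwise limit, in operator norm** (finite-dimensional source). [folklore] -/
theorem tendsto_fderiv_of_tendsto_of_taylor [FiniteDimensional ℝ E] {f : ι → E → F} {g : E → F} {x : E}
    {r K : ℝ} (hr : 0 < r) (hlim : ∀ y ∈ ball x r, Tendsto (fun i => f i y) l (𝓝 (g y)))
    (htaylor : ∀ᶠ i in l, ∀ h : E, ‖h‖ < r → ‖f i (x + h) - f i x - fderiv ℝ (f i) x h‖ ≤ K * ‖h‖ ^ 2)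
    (hg : DifferentiableAt ℝ g x) :
    Tendsto (fun i => fderiv ℝ (f i) x) l (𝓝 (fderiv ℝ g x)) := by
  set b := Module.finBasis ℝ E with hb
  obtain ⟨C, hC, hCb⟩ := b.exists_opNorm_le (F := F)
  rw [Metric.tendsto_nhds]
  intro ε hε
  have hε' : 0 < ε / (2 * C) := by positivity
  have hall : ∀ᶠ i in l, ∀ k, ‖fderiv ℝ (f i) x (b k) - fderiv ℝ g x (b k)‖ < ε / (2 * C) := by
    refine Filter.eventually_all.2 fun k => ?_
    have h := tendsto_fderiv_apply_of_tendsto_of_taylor hr hlim htaylor hg (b k)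
    exact ((Metric.tendsto_nhds.1 h) _ hε').mono fun i hi => by rwa [dist_eq_norm] at hi
  filter_upwards [hall] with i hi
  rw [dist_eq_norm]
  have hle : ‖fderiv ℝ (f i) x - fderiv ℝ g x‖ ≤ C * (ε / (2 * C)) :=
    hCb (u := fderiv ℝ (f i) x - fderiv ℝ g x) hε'.le fun k => by
      rw [FunLike.coe_sub, Pi.sub_apply]; exact (hi k).le
  calc ‖fderiv ℝ (f i) x - fderiv ℝ g x‖ ≤ C * (ε / (2 * C)) := hle
    _ = ε / 2 := by field_simp
    _ < ε := by linarith

/-- **Linear rate from a bounded derivative and a vanishing left trace at `0`.**  If `φ` has derivative `φ′`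
on `]s₀, 0[` with `‖φ′‖ ≤ K` and `φ(s) → 0` as `s ↑ 0`, then `‖φ s‖ ≤ K (−s)` on `]s₀, 0[`. [folklore] -/
theorem norm_le_mul_of_deriv_bound_of_tendsto_zero {φ φ' : ℝ → F} {s₀ K : ℝ}
    (hφ : ∀ s ∈ Ioo s₀ 0, HasDerivAt φ (φ' s) s) (hK : ∀ s ∈ Ioo s₀ 0, ‖φ' s‖ ≤ K)
    (htop : Tendsto φ (𝓝[<] 0) (𝓝 0)) {s : ℝ} (hs : s ∈ Ioo s₀ 0) : ‖φ s‖ ≤ K * (-s) := by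
  -- `‖φ t - φ s‖ ≤ K (t - s)` for `s ≤ t < 0`, then `t ↑ 0`
  have hseg : ∀ t ∈ Ico s 0, ‖φ t - φ s‖ ≤ K * (t - s) := by
    intro t ht
    have hderiv : ∀ τ ∈ Icc s t, HasDerivWithinAt φ (φ' τ) (Icc s t) τ := fun τ hτ =>
      (hφ τ ⟨hs.1.trans_le hτ.1, hτ.2.trans_lt ht.2⟩).hasDerivWithinAt
    have hbound : ∀ τ ∈ Ico s t, ‖φ' τ‖ ≤ K := fun τ hτ =>
      hK τ ⟨hs.1.trans_le hτ.1, hτ.2.trans ht.2⟩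
    exact norm_image_sub_le_of_norm_deriv_le_segment' hderiv hbound t (right_mem_Icc.2 ht.1)
  have hlim : Tendsto (fun t => ‖φ t - φ s‖) (𝓝[<] 0) (𝓝 ‖0 - φ s‖) :=
    ((htop.sub tendsto_const_nhds).norm)
  have hlim2 : Tendsto (fun t : ℝ => K * (t - s)) (𝓝[<] 0) (𝓝 (K * (0 - s))) :=
    ((tendsto_id.mono_left nhdsWithin_le_nhds).sub tendsto_const_nhds).const_mul K
  have hev : ∀ᶠ t in 𝓝[<] (0 : ℝ), ‖φ t - φ s‖ ≤ K * (t - s) := by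
    filter_upwards [Ico_mem_nhdsLT hs.2] with t ht using hseg t ht
  have := le_of_tendsto_of_tendsto hlim hlim2 hev
  simpa using this

end Summit.NavierStokesRegularity.NavierStokesRegularity.Theorems.LocalIrrotationalScarDoorZoomTraceTools

end
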